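import Summits.RiemannHypothesis.RiemannHypothesis.Theses.IntegerScrew
import HarnessLib

/-!
# Route IntegerScrew — `FloorImpliesScrew` (item stmt-RiemannHypothesis-15759)

The polynomial floor implies the target: a configuration `t : Fin N → log ℕ` with coefficients `x`
AGGREGATES (sum the `x` over equal points) to a vector `y` on `{1, …, M}`, `M = Σᵢ mᵢ ≥ max mᵢ`;
the double sum regroups fibrewise (`Finset.sum_fiberwise_of_maps_to`); the `m = 1` row and column
of `G` vanish (`Ψ(0) = 0`: `zetaScrewKernel_zero_left/right`), so the form equals the `{2..M}` form
of the aggregated vector, which the floor bounds below by `c M^{−A} Σ y² ≥ 0`.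
-/

-- `Summit.RiemannHypothesis.RiemannHypothesis.…` duplicates `RiemannHypothesis` BY DESIGN (D-0017).
set_option linter.dupNamespace false

noncomputable section

namespace Summit.RiemannHypothesis.RiemannHypothesis.Theorems

open Literature.NumberTheory.LFunctions
open scoped BigOperators
open Finset

namespace IntegerScrew

/-- Fibrewise regrouping of a weighted sum along `m : Fin N → ℕ` with values in `S`:
`Σᵢ h(mᵢ) xᵢ = Σ_{l ∈ S} h(l) · y_l` where `y_l = Σ_{i : mᵢ = l} xᵢ`. -/
theorem sum_eq_sum_fiber {N : ℕ} (m : Fin N → ℕ) (x : Fin N → ℝ) (S : Finset ℕ)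
    (hS : ∀ i, m i ∈ S) (h : ℕ → ℝ) (y : ℕ → ℝ)
    (hy : ∀ l, y l = ∑ i ∈ Finset.univ.filter (fun i => m i = l), x i) :
    ∑ i, h (m i) * x i = ∑ l ∈ S, h l * y l := by
  classical
  rw [← Finset.sum_fiberwise_of_maps_to (s := Finset.univ) (t := S) (g := m)
    (fun i _ => hS i) (fun i => h (m i) * x i)]
  refine Finset.sum_congr rfl fun l _ => ?_
  rw [hy l, Finset.mul_sum]
  refine Finset.sum_congr rfl fun i hi => ?_
  simp only [Finset.mem_filter] at hi
  rw [hi.2]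

/-- Fibrewise regrouping of the double sum: with `y_l = Σ_{i : mᵢ = l} xᵢ`,
`Σᵢⱼ K(mᵢ, mⱼ) xᵢ xⱼ = Σ_{k,l ∈ S} K(k,l) y_k y_l`. -/
theorem sum_sum_eq_sum_sum_fiber {N : ℕ} (m : Fin N → ℕ) (x : Fin N → ℝ) (S : Finset ℕ)
    (hS : ∀ i, m i ∈ S) (Kf : ℕ → ℕ → ℝ) (y : ℕ → ℝ)
    (hy : ∀ l, y l = ∑ i ∈ Finset.univ.filter (fun i => m i = l), x i) :
    ∑ i, ∑ j, Kf (m i) (m j) * (x i * x j) = ∑ k ∈ S, ∑ l ∈ S, Kf k l * (y k * y l) := by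
  have step1 : ∀ i, ∑ j, Kf (m i) (m j) * (x i * x j) = (∑ l ∈ S, Kf (m i) l * y l) * x i := by
    intro i
    have e : ∀ j, Kf (m i) (m j) * (x i * x j) = x i * (Kf (m i) (m j) * x j) := fun j => by ring
    simp_rw [e]
    rw [← Finset.mul_sum, sum_eq_sum_fiber m x S hS (Kf (m i)) y hy, mul_comm]
  simp_rw [step1]
  have step2 := sum_eq_sum_fiber m x S hS (fun k => ∑ l ∈ S, Kf k l * y l) y hy
  rw [step2]
  refine Finset.sum_congr rfl fun k _ => ?_
  rw [Finset.sum_mul]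
  refine Finset.sum_congr rfl fun l _ => ?_
  ring

end IntegerScrew

open IntegerScrew in
/-- **`FloorImpliesScrew`** (route IntegerScrew, item stmt-RiemannHypothesis-15759): a polynomial
floor `c M^{−A} Σ_{2≤m≤M} x_m² ≤ x·S_M·x` for all `M, x` implies that Suzuki's kernel is positive
semidefinite on every finite configuration of logarithms of positive integers (aggregate the
coefficients over equal points; the point `log 1 = 0` carries a vanishing row and column). -/
theorem floorImpliesScrew_proof :
    Summit.RiemannHypothesis.RiemannHypothesis.Theses.IntegerScrew.FloorImpliesScrew := by
  classical
  rintro ⟨A, c, hc, hfloor⟩ N t x ht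
  choose m hm1 hmt using ht
  -- aggregation level `M = Σ mᵢ` and aggregated vector `y`
  set M : ℕ := ∑ i, m i with hM
  have hmM : ∀ i, m i ∈ Icc 1 M := fun i =>
    Finset.mem_Icc.mpr ⟨hm1 i, by
      rw [hM]
      exact Finset.single_le_sum (fun j _ => Nat.zero_le (m j)) (Finset.mem_univ i)⟩
  obtain ⟨y, hy⟩ : ∃ y : ℕ → ℝ, ∀ l, y l = ∑ i ∈ Finset.univ.filter (fun i => m i = l), x i :=
    ⟨_, fun l => rfl⟩
  -- regroup the double sum over the values
  have hregroup : ∑ i, ∑ j, zetaScrewKernel (t i) (t j) * (x i * x j) =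
      ∑ k ∈ Icc 1 M, ∑ l ∈ Icc 1 M,
        zetaScrewKernel (Real.log k) (Real.log l) * (y k * y l) := by
    simp_rw [hmt]
    exact sum_sum_eq_sum_sum_fiber m x (Icc 1 M) hmM
      (fun k l : ℕ => zetaScrewKernel (Real.log k) (Real.log l)) y hy
  -- drop the vanishing row/column `k = 1`, `l = 1`
  have hsub : Icc 2 M ⊆ Icc 1 M := fun k hk => by
    simp only [Finset.mem_Icc] at hk ⊢; omega
  have hout : ∀ k, k ∈ Icc 1 M → k ∉ Icc 2 M → k = 1 := fun k hk hk' => by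
    simp only [Finset.mem_Icc, not_and, not_le] at hk hk'; omega
  have hdrop2 : ∀ k : ℕ, ∑ l ∈ Icc 2 M, zetaScrewKernel (Real.log k) (Real.log l) * (y k * y l) =
      ∑ l ∈ Icc 1 M, zetaScrewKernel (Real.log k) (Real.log l) * (y k * y l) := fun k =>
    Finset.sum_subset hsub fun l hl hl' => by
      rw [hout l hl hl']
      simp
  have hdrop1 : ∑ k ∈ Icc 2 M, ∑ l ∈ Icc 1 M,
        zetaScrewKernel (Real.log k) (Real.log l) * (y k * y l) =
      ∑ k ∈ Icc 1 M, ∑ l ∈ Icc 1 M,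
        zetaScrewKernel (Real.log k) (Real.log l) * (y k * y l) :=
    Finset.sum_subset hsub fun k hk hk' => by
      rw [hout k hk hk']
      simp
  rw [hregroup, ← hdrop1]
  simp_rw [← hdrop2]
  have h := hfloor M y
  have hL : 0 ≤ c * (M : ℝ) ^ (-A) * ∑ l ∈ Icc 2 M, y l ^ 2 :=
    mul_nonneg (mul_nonneg hc.le (Real.rpow_nonneg (Nat.cast_nonneg M) _))
      (Finset.sum_nonneg fun _ _ => sq_nonneg _)
  exact le_trans hL h

end Summit.RiemannHypothesis.RiemannHypothesis.Theorems

end
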